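import Summits.QuantumFields.YangMills.Theorems.BalabanUVNodesN19LipschitzLinksMomentFirstOrder
import Summits.QuantumFields.YangMills.Theorems.BalabanUVNodesN19LipschitzLinkJacksonSmoothing
import Summits.QuantumFields.YangMills.Theorems.BalabanUVNodesN19SingleModeMomentLogFreeBudget
import Summits.QuantumFields.YangMills.Theorems.BalabanUVNodesN19OscillatingLinksMomentDiscrepancy

/-!
# YM-DAG node N19 (= NE7 proper) — EVERY LIPSCHITZ LINK OF THE ℓ¹-NORM IN THE UNIFORM MIXED-MOMENT CURRENCY, AT THE RIDGE RATE UP TO `log²`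
# (laws with `e^{−L}`-close mixed moments: `|∫h(Σ|x_i|)dP − ∫h(Σ|x_i|)dQ| ≤ 3·10⁶·K·d·log₂²L∕L` — module 156 with the Jackson kernel: `log³ → log²`)

Cell `pub-ymgap`, HUMAN RULING D-0062 (Track A) ∕ D-0149 (work-bound push), R141 (C) wider-strategy seat `pub-ymgap-dag-n19-e` (strategy
s3 = ALTERNATIVE CURRENCY), generation g33, module 23 (lineage module 170).  Route `Summits/QuantumFields/YangMills/Theses/BalabanUVNodes.lean`,
cluster item K3⁸ «SpineGivenEndpointR13SepCoPHV» (stmt-QuantumFields-27366); filed `--supports` that item `--as helper` (it proves no registered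
stub).  COUNT-NEUTRAL: [folklore]∕[bookkeeping] over Mathlib and the lineage BY NAME — module 155 `…N19LipschitzLinksMomentFirstOrder`
(`exists_mvPolynomial_near_trigLink_firstOrder_mass`), module 167 `…N19LipschitzLinkJacksonSmoothing` (`exists_trigLink_near_lipschitzLink_jackson`:
the LOG-FREE Jackson–Steklov smoothing), module 145 `…N19SingleModeMomentLogFreeBudget` (`abs_integral_sub_le_of_near_mass`, `exists_scale_L`,
`exists_order_L`, `logmass_le`), module 125 (`continuous_l1Norm`), module 120 (`l1Norm_mem_Icc`), module 56 (`integrable_of_continuous_of_cube`); TOY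
laws under HYPOTHESES; no scheme object, no Theses import; NOT a discharge claim.

THE RESULT.  Module 156 (`…N19LipschitzLinksMomentBudget`) priced every `K`-Lipschitz link of `Σ_i|x_i|` in the uniform mixed-moment currency at
`1.2·10⁵·K·d·log₂³L∕L`; one of its three logarithms was the Fejér kernel's `(1 + log L_F)`.  THIS MODULE runs the same bookkeeping on module 167's
Jackson smoothing (error `Kd(1∕π + 3π⁴∕32)∕L_F`, NO logarithm; frequencies `≤ 2L_Fπ∕d`, mass `≤ π⁴KdL_F∕8`): ★★★
`abs_integral_lipschitzLink_l1Norm_sub_le_of_closeMoments_logSq` — **for probability laws `P, Q` on `ℝ^ι` carried by `[−1,1]^ι` with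
`|∫∏x_i^{j_i}dP − ∫∏x_i^{j_i}dQ| ≤ e^{−L}` for every multi-index `j`, `L ≥ 2^28`, and every `h` with `|h(s) − h(s′)| ≤ K|s − s′|` on `ℝ` (`K ≥ 0`):
`|∫h(Σ_i|x_i|)dP − ∫h(Σ_i|x_i|)dQ| ≤ 3·10⁶·K·d·(log₂L)²∕L`** (`d = |ι| ≥ 1`) — the ridge rate up to `log²` (better than module 156 for every
`L ≥ 2^28`, since `3·10⁶ < 1.2·10⁵·28`).  THE MECHANISM: Fejér order `L_F = ⌊L∕(104000 log₂²L)⌋`, `a = Ωd = 2L_Fπ` (`aΛ² ≤ L∕16384`), module 145's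
scale ∕ order ∕ `N = ⌊L∕16⌋` ∕ log-mass budget verbatim, `mass·e^{−L} ≤ (π⁴KdL_F∕8)e^{−L∕2} ≤ π⁴Kd∕L`; sup part: smoothing `1474600KdΛ²∕L`, second
order `64Kd∕L`, first order `54Kd∕L`, ladder `19Kd∕L`.  §1 `logb_sq_le_L28`, `exists_parameters_L2`; §2 `errorBound_L2`; §3 the theorem.

HONEST FRAMING (binding).  Elementary and [folklore]; TOY laws under hypotheses; constants astronomical (`3·10⁶`, `2^28`), nowhere optimised; NO
consumer in the DAG today (the seat's own currency map); nothing of Bałaban's instantiated; NE7 NOT PRINTED, NOT proved; N19 NOT discharged;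
count-neutral.  One finite `T⁴` programme at fixed `ε`; nothing continuum ∕ `ℝ⁴` ∕ OS ∕ mass-gap ∕ Clay.  0 `def` ∕ 0 `sorry`.
-/

noncomputable section

open Finset MeasureTheory
open scoped Real

namespace Summit.QuantumFields.YangMills.Theorems.BalabanUVNodesN19LipschitzLinksMomentBudgetLogSq

open Summit.QuantumFields.YangMills.Theorems.BalabanUVNodesN19LipschitzLinksMomentFirstOrder (exists_mvPolynomial_near_trigLink_firstOrder_mass)
open Summit.QuantumFields.YangMills.Theorems.BalabanUVNodesN19LipschitzLinkJacksonSmoothing (exists_trigLink_near_lipschitzLink_jackson)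
open Summit.QuantumFields.YangMills.Theorems.BalabanUVNodesN19SingleModeMomentLogFreeBudget
  (abs_integral_sub_le_of_near_mass exists_scale_L exists_order_L logmass_le)
open Summit.QuantumFields.YangMills.Theorems.BalabanUVNodesN19OscillatingLinksMomentDiscrepancy (continuous_l1Norm)
open Summit.QuantumFields.YangMills.Theorems.BalabanUVNodesN19OscillatingLinksMultiscale (l1Norm_mem_Icc)
open Summit.QuantumFields.YangMills.Theorems.BalabanUVNodesN19JointLawBernstein (integrable_of_continuous_of_cube)

variable {ι : Type*} [Fintype ι]

/-! ## §1 The parameters at budget `L` [bookkeeping] -/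

/-- `log₂L ≥ 28` and `312000·log₂²L ≤ L` for real `L ≥ 2^28` (`(1 + v∕28)² ≤ e^{2v∕28} ≤ 2^v`). [bookkeeping] -/
theorem logb_sq_le_L28 {L : ℝ} (hL : (2 : ℝ) ^ (28 : ℕ) ≤ L) : 28 ≤ Real.logb 2 L ∧ 312000 * Real.logb 2 L ^ 2 ≤ L := by
  set u : ℝ := Real.logb 2 L with hu
  have hL0 : 0 < L := lt_of_lt_of_le (by positivity) hL
  have htr : (2 : ℝ) ^ (28 : ℝ) ≤ L := by
    rw [show (28 : ℝ) = ((28 : ℕ) : ℝ) by norm_num, Real.rpow_natCast]; exact hL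
  have hu28 : 28 ≤ u := by rw [hu, Real.le_logb_iff_rpow_le one_lt_two hL0]; exact htr
  refine ⟨hu28, ?_⟩
  have hLu : L = 2 ^ u := by rw [hu, Real.rpow_logb two_pos (by norm_num) hL0]
  set v : ℝ := u - 28 with hv
  have hv0 : 0 ≤ v := by linarith
  have h2u : (2 : ℝ) ^ u = 2 ^ (28 : ℝ) * 2 ^ v := by rw [← Real.rpow_add two_pos]; congr 1; ring
  have h28 : (2 : ℝ) ^ (28 : ℝ) = 268435456 := by rw [show (28 : ℝ) = ((28 : ℕ) : ℝ) by norm_num, Real.rpow_natCast]; norm_num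
  have h1 : (1 + v / 28) ^ 2 ≤ Real.exp (2 * v / 28) := by
    have h := Real.add_one_le_exp (v / 28)
    have h0 : 0 ≤ 1 + v / 28 := by linarith
    calc (1 + v / 28) ^ 2 ≤ Real.exp (v / 28) ^ 2 := pow_le_pow_left₀ h0 (by linarith) 2
      _ = Real.exp (2 * v / 28) := by rw [← Real.exp_nat_mul]; congr 1; push_cast; ring
  have h2 : Real.exp (2 * v / 28) ≤ (2 : ℝ) ^ v := by
    rw [Real.rpow_def_of_pos two_pos, Real.exp_le_exp]
    have := Real.log_two_gt_d9
    nlinarith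
  have husq : u ^ 2 = 784 * (1 + v / 28) ^ 2 := by rw [hv]; ring
  calc 312000 * u ^ 2 = 244608000 * (1 + v / 28) ^ 2 := by rw [husq]; ring
    _ ≤ 244608000 * (2 : ℝ) ^ v := by nlinarith [h1.trans h2]
    _ ≤ 268435456 * (2 : ℝ) ^ v := by nlinarith [Real.rpow_nonneg (by norm_num : (0 : ℝ) ≤ 2) v]
    _ = L := by rw [hLu, h2u, h28]

/-- **THE PARAMETERS AT BUDGET `L ≥ 2^28` (Jackson smoothing).**  With `Λ = log₂L`: a Fejér order `L_F ≥ 1` with `L ≤ 156000Λ²L_F` and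
`104000Λ²L_F ≤ L` (so `a = 2L_Fπ` has `aΛ² ≤ L∕16384`); module 145's scale `J` and order `h` (`(aπ∕2^J)² ≤ 64a∕L`, `aπ ≤ 2^J ≤ L∕4`, `1 ≤ h`,
`(J+1)e^{−h} ≤ ½`, `e^{−h} ≤ L^{−3}`); the Jackson order `N = ⌊L∕16⌋` (`2^J ≤ N`, `L∕17 ≤ N`); and the LOG-MASS BUDGET
`Λ(a) + log(1 + 2aN9^N) ≤ L∕2` (`logmass_le`). [bookkeeping] -/
theorem exists_parameters_L2 {L : ℝ} (hL : (2 : ℝ) ^ (28 : ℕ) ≤ L) :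
    ∃ LF J h N : ℕ, 1 ≤ LF ∧ L ≤ 156000 * Real.logb 2 L ^ 2 * LF ∧ 104000 * Real.logb 2 L ^ 2 * LF ≤ L ∧
      1 ≤ h ∧ ((J : ℝ) + 1) * Real.exp (-(h : ℝ)) ≤ 1 / 2 ∧ Real.exp (-(h : ℝ)) ≤ 1 / L ^ 3 ∧ (J : ℝ) + 1 ≤ L / 4 ∧
      2 * (LF : ℝ) * π * π ≤ 2 ^ J ∧ 2 ^ J ≤ N ∧ (2 * (LF : ℝ) * π * π / 2 ^ J) ^ 2 ≤ 64 * (2 * LF * π) / L ∧ L / 17 ≤ N ∧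
      ((J : ℝ) + 1) * Real.log 2 + (6 * π * Real.exp 2 * (2 * LF * π) + h * ((J : ℝ) + 1)) * Real.log (1 + 10 * (2 * LF * π)) +
          (3 * π * Real.exp 2 * (2 * LF * π) * ((J : ℝ) + 1) + h * (2 ^ (J + 1) - 1)) * Real.log 81 +
          Real.log (1 + 2 * (2 * LF * π) * (N * 9 ^ N)) ≤ L / 2 := by
  obtain ⟨hΛ28, hΛsq⟩ := logb_sq_le_L28 hL
  set Λ : ℝ := Real.logb 2 L with hΛ
  have hL0 : 0 < L := lt_of_lt_of_le (by positivity) hL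
  have hLge : (268435456 : ℝ) ≤ L := le_trans (by norm_num) hL
  have hL1024 : (1024 : ℝ) ≤ L := by linarith
  have hπlo : 3.14 < π := Real.pi_gt_d2
  have hπhi : π < 3.15 := Real.pi_lt_d2
  have hΛ2 : 0 < Λ ^ 2 := by positivity
  -- the Fejér order
  set x : ℝ := L / (104000 * Λ ^ 2) with hx
  have hx3 : 3 ≤ x := by rw [hx, le_div_iff₀ (by positivity)]; linarith only [hΛsq]
  set LF : ℕ := ⌊x⌋₊ with hLF
  have hLFx : (LF : ℝ) ≤ x := Nat.floor_le (by linarith)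
  have hxLF : x < LF + 1 := Nat.lt_floor_add_one x
  have hLF1 : 1 ≤ LF := by
    have h2 : (0 : ℝ) < LF := by linarith
    exact_mod_cast (show 0 < LF by exact_mod_cast h2)
  have hLFr : (1 : ℝ) ≤ LF := by exact_mod_cast hLF1
  have hP2 : L ≤ 156000 * Λ ^ 2 * LF := by
    have hLx : L = 104000 * Λ ^ 2 * x := by rw [hx]; field_simp
    have hLF23 : 2 * x / 3 ≤ LF := by linarith only [hx3, hxLF]
    rw [hLx]
    have := mul_le_mul_of_nonneg_left hLF23 (by positivity : (0 : ℝ) ≤ 156000 * Λ ^ 2)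
    linarith only [this]
  have hP3 : 104000 * Λ ^ 2 * (LF : ℝ) ≤ L := by
    have := mul_le_mul_of_nonneg_left hLFx (by positivity : (0 : ℝ) ≤ 104000 * Λ ^ 2)
    rw [hx, mul_div_cancel₀ _ (by positivity)] at this
    exact this
  -- module 145's scale and order with `a = 2 L_F π`
  set a : ℝ := 2 * LF * π with ha
  have ha0 : 0 ≤ a := by positivity
  have hreg : a * Λ ^ 2 ≤ L / 16384 := by
    have h1 : a * Λ ^ 2 ≤ 6.3 * (Λ ^ 2 * LF) := by
      rw [ha, show 2 * (LF : ℝ) * π * Λ ^ 2 = (2 * π) * (Λ ^ 2 * LF) by ring]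
      exact mul_le_mul_of_nonneg_right (by linarith only [hπhi]) (by positivity)
    have hX : Λ ^ 2 * (LF : ℝ) ≤ L / 104000 := by rw [le_div_iff₀ (by norm_num)]; linarith only [hP3]
    have h2 : 6.3 * (Λ ^ 2 * (LF : ℝ)) ≤ 6.3 * (L / 104000) := mul_le_mul_of_nonneg_left hX (by norm_num)
    have h3 : 6.3 * (L / 104000) ≤ L / 16384 := by
      rw [mul_div_assoc', div_le_div_iff₀ (by norm_num) (by norm_num)]; nlinarith only [hL0]
    linarith only [h1, h2, h3]
  have hbig : 64 < π ^ 2 * a * L := by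
    have h1 : (1 : ℝ) ≤ a := by rw [ha]; nlinarith only [hLFr, hπlo]
    have h2 : 9 ≤ π ^ 2 := by nlinarith only [hπlo, Real.pi_pos]
    have h3 : (9 : ℝ) * 1 * 268435456 ≤ π ^ 2 * a * L :=
      mul_le_mul (mul_le_mul h2 h1 zero_le_one (by positivity)) hLge (by positivity) (by positivity)
    linarith only [h3]
  obtain ⟨J, hJsq, hJa, hMlt, hJ4, hJ1Λ⟩ := exists_scale_L hL1024 ha0 hreg hbig
  obtain ⟨h, hh1, hhle, hexph⟩ := exists_order_L hL1024
  have hM0 : (0 : ℝ) < 2 ^ J := by positivity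
  have hJ12J : (J : ℝ) + 1 ≤ 2 ^ J := by exact_mod_cast (Nat.lt_two_pow_self : J + 1 ≤ 2 ^ J)
  have hJ1 : (J : ℝ) + 1 ≤ L / 4 := hJ12J.trans hJ4
  have hP5 : ((J : ℝ) + 1) * Real.exp (-(h : ℝ)) ≤ 1 / 2 := by
    calc ((J : ℝ) + 1) * Real.exp (-(h : ℝ)) ≤ (L / 4) * (1 / L ^ 3) := mul_le_mul hJ1 hexph (Real.exp_pos _).le (by positivity)
      _ = 1 / (4 * L ^ 2) := by field_simp
      _ ≤ 1 / 2 := by rw [div_le_div_iff₀ (by positivity) (by norm_num : (0 : ℝ) < 2)]; nlinarith only [hLge]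
  -- the Jackson order `N = ⌊L/16⌋`
  set N : ℕ := ⌊L / 16⌋₊ with hN
  have hNle : (N : ℝ) ≤ L / 16 := Nat.floor_le (by positivity)
  have hNge : L / 16 - 1 ≤ N := by have := Nat.lt_floor_add_one (L / 16); linarith
  have hN1 : (1 : ℝ) ≤ N := by linarith
  have hN17 : L / 17 ≤ N := by
    have : L / 17 ≤ L / 16 - 1 := by rw [div_le_iff₀ (by norm_num : (0 : ℝ) < 17)]; nlinarith only [hLge]
    linarith
  have hNJ : 2 ^ J ≤ N := by
    have hΛ10 : 10 ≤ Λ := by linarith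
    have hM10 : (2 : ℝ) ^ J * 5120 ≤ 2 ^ J * (512 * Λ) := by nlinarith only [hΛ10, hM0]
    have hMle : (2 : ℝ) ^ J ≤ L / 1625 := by nlinarith only [hM10, hMlt, hπhi, hL0]
    have h1 : ((2 ^ J : ℕ) : ℝ) ≤ (N : ℝ) := by push_cast; linarith only [hMle, hNge, hLge]
    exact_mod_cast h1
  -- the log-mass budget
  have h9 : ((9 : ℝ) ^ N : ℝ) = (9 : ℝ) ^ ((N : ℕ) : ℝ) := (Real.rpow_natCast 9 N).symm
  have hbudget := logmass_le (M := (2 : ℝ) ^ J) (N := (N : ℝ)) (Jr := (J : ℝ)) hL1024 ha0 hreg hJ12J (Nat.cast_nonneg J) hJ1Λ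
    hMlt.le hhle hN1 hNle
  rw [← h9] at hbudget
  have e2 : (2 : ℝ) * 2 ^ J - 1 = 2 ^ (J + 1) - 1 := by rw [pow_succ]; ring
  rw [e2] at hbudget
  refine ⟨LF, J, h, N, hLF1, hP2, hP3, hh1, hP5, hexph, hJ1, ?_, hNJ, ?_, hN17, ?_⟩
  · rw [ha] at hJa; simpa [mul_assoc] using hJa
  · have e : 2 * (LF : ℝ) * π * π / 2 ^ J = a * π / 2 ^ J := by rw [ha]
    rw [e]; simpa [ha] using hJsq
  · simpa [ha] using hbudget

/-! ## §2 The error bookkeeping at budget `L` [bookkeeping] -/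

/-- THE SUP-ERROR BOOKKEEPING AT BUDGET `L` (`M = 2^J`, `ε = 2(J+1)e^{−h} ≤ 1∕(2L²)`): smoothing `Kd(1∕π + 3π⁴∕32)∕L_F ≤ 1474600KdΛ²∕L` (NO third
logarithm), second order `≤ 64Kd∕L`, first order `≤ 54Kd∕L`, ladder `≤ 19Kd∕L`; total `≤ 1474800KdΛ²∕L`. [bookkeeping] -/
theorem errorBound_L2 {K d L Λ LF M N ε : ℝ} (hK : 0 ≤ K) (hd : 0 < d) (hL : 268435456 ≤ L) (hΛ : 28 ≤ Λ) (hLF1 : 1 ≤ LF)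
    (hLFL : LF ≤ L) (hLLF : L ≤ 156000 * Λ ^ 2 * LF) (hM : 2 * LF * π * π ≤ M) (hMN : M ≤ N)
    (hJsq : (2 * LF * π * π / M) ^ 2 ≤ 64 * (2 * LF * π) / L) (hN17 : L / 17 ≤ N) (hε : ε ≤ 1 / (2 * L ^ 2)) :
    K * d * (1 / π + 3 * π ^ 4 / 32) / LF +
      (K * π * LF / d * (d * π / M) ^ 2 + K * (d * π / N) +
        ε * (π ^ 4 * (K * d) * LF / 8) * (1 + 2 * LF * π / d * (d * π / M + d * π / N))) ≤
        1474800 * K * d * Λ ^ 2 / L := by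
  have hπlo : 3.14 < π := Real.pi_gt_d2
  have hπhi : π < 3.15 := Real.pi_lt_d2
  have hπ := Real.pi_pos
  have hL0 : 0 < L := by linarith
  have hLF0 : 0 < LF := by linarith
  have hM0 : 0 < M := lt_of_lt_of_le (by positivity) hM
  have hN0 : 0 < N := lt_of_lt_of_le hM0 hMN
  have hKd : 0 ≤ K * d := mul_nonneg hK hd.le
  have hΛ0 : 0 < Λ := by linarith
  -- smoothing (NO logarithm)
  have hT1 : K * d * (1 / π + 3 * π ^ 4 / 32) / LF ≤ 1474600 * K * d * Λ ^ 2 / L := by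
    have hπlo4 : 3.1415 < π := Real.pi_gt_d4
    have hπhi4 : π < 3.1416 := Real.pi_lt_d4
    have h1 : 1 / π ≤ 0.3184 := by rw [div_le_iff₀ hπ]; nlinarith only [hπlo4]
    have hπ2 : π ^ 2 < 3.1416 * 3.1416 := by rw [pow_two]; exact mul_lt_mul'' hπhi4 hπhi4 hπ.le hπ.le
    have hπ4 : π ^ 4 ≤ 97.42 := by nlinarith only [hπ2, pow_pos hπ 2]
    have h2 : 1 / π + 3 * π ^ 4 / 32 ≤ 9.452 := by linarith only [h1, hπ4]
    have h3 : K * d * (1 / π + 3 * π ^ 4 / 32) / LF ≤ K * d * 9.452 / LF :=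
      div_le_div_of_nonneg_right (mul_le_mul_of_nonneg_left h2 hKd) hLF0.le
    refine h3.trans ?_
    rw [div_le_div_iff₀ hLF0 hL0]
    have h4 := mul_le_mul_of_nonneg_left hLLF (by positivity : (0 : ℝ) ≤ K * d * 9.452)
    have h5 : 0 ≤ K * d * Λ ^ 2 * LF := by positivity
    nlinarith only [h4, h5]
  -- second order
  have hT2 : K * π * LF / d * (d * π / M) ^ 2 ≤ 64 * K * d / L := by
    have e : K * π * LF / d * (d * π / M) ^ 2 = K * d * (π ^ 3 * LF / M ^ 2) := by field_simp
    have h1 : π ^ 3 * LF / M ^ 2 ≤ 64 / L := by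
      have h2 : (2 * LF * π * π / M) ^ 2 = (4 * LF * π) * (π ^ 3 * LF / M ^ 2) := by field_simp; ring
      have h3 : (4 * LF * π) * (π ^ 3 * LF / M ^ 2) ≤ (4 * LF * π) * (32 / L) := by
        calc (4 * LF * π) * (π ^ 3 * LF / M ^ 2) = (2 * LF * π * π / M) ^ 2 := h2.symm
          _ ≤ 64 * (2 * LF * π) / L := hJsq
          _ = (4 * LF * π) * (32 / L) := by ring
      have h4 := le_of_mul_le_mul_left h3 (by positivity)
      have h5 : (32 : ℝ) / L ≤ 64 / L := div_le_div_of_nonneg_right (by norm_num) hL0.le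
      exact h4.trans h5
    rw [e]
    calc K * d * (π ^ 3 * LF / M ^ 2) ≤ K * d * (64 / L) := mul_le_mul_of_nonneg_left h1 hKd
      _ = 64 * K * d / L := by ring
  -- first order
  have hT3 : K * (d * π / N) ≤ 54 * K * d / L := by
    have h1 : d * π / N ≤ 54 * d / L := by
      rw [div_le_div_iff₀ hN0 hL0]
      have e1 : d * π * L ≤ 3.15 * (d * L) := by
        rw [show d * π * L = π * (d * L) by ring]
        exact mul_le_mul_of_nonneg_right hπhi.le (by positivity)
      have e2 := mul_le_mul_of_nonneg_left hN17 (by positivity : (0 : ℝ) ≤ 54 * d)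
      have e3 : 0 ≤ d * L := by positivity
      linarith only [e1, e2, e3]
    calc K * (d * π / N) ≤ K * (54 * d / L) := mul_le_mul_of_nonneg_left h1 hK
      _ = 54 * K * d / L := by ring
  -- ladder
  have hT4 : ε * (π ^ 4 * (K * d) * LF / 8) * (1 + 2 * LF * π / d * (d * π / M + d * π / N)) ≤ 19 * K * d / L := by
    have h1 : 2 * LF * π / d * (d * π / M) ≤ 1 := by
      rw [show 2 * LF * π / d * (d * π / M) = 2 * LF * π * π / M by field_simp, div_le_one hM0]; exact hM
    have h2 : 2 * LF * π / d * (d * π / N) ≤ 1 := by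
      rw [show 2 * LF * π / d * (d * π / N) = 2 * LF * π * π / N by field_simp, div_le_one hN0]; exact hM.trans hMN
    have h3 : 1 + 2 * LF * π / d * (d * π / M + d * π / N) ≤ 3 := by rw [mul_add]; linarith only [h1, h2]
    have hπ2 : π ^ 2 < 3.15 * 3.15 := by rw [pow_two]; exact mul_lt_mul'' hπhi hπhi hπ.le hπ.le
    have hπ4 : π ^ 4 ≤ 98.5 := by nlinarith only [hπ2, pow_pos hπ 2]
    have hW : π ^ 4 * (K * d) * LF / 8 ≤ 12.32 * (K * d) * LF := by
      rw [div_le_iff₀ (by norm_num : (0 : ℝ) < 8)]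
      have := mul_le_mul_of_nonneg_right hπ4 (by positivity : (0 : ℝ) ≤ K * d * LF)
      have h0 : 0 ≤ K * d * LF := by positivity
      nlinarith only [this, h0]
    have h4 : ε * (π ^ 4 * (K * d) * LF / 8) * (1 + 2 * LF * π / d * (d * π / M + d * π / N)) ≤
        (1 / (2 * L ^ 2)) * (12.32 * (K * d) * LF) * 3 :=
      mul_le_mul (mul_le_mul hε hW (by positivity) (by positivity)) h3 (by positivity) (by positivity)
    refine h4.trans ?_
    rw [show 1 / (2 * L ^ 2) * (12.32 * (K * d) * LF) * 3 = 18.48 * K * d * LF / L ^ 2 by field_simp; ring,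
      div_le_div_iff₀ (by positivity) hL0]
    have := mul_le_mul_of_nonneg_left hLFL (by positivity : (0 : ℝ) ≤ 19 * K * d * L)
    nlinarith only [this, hKd, hL0, hLF0]
  -- total
  have hΛ2 : 137 ≤ 200 * Λ ^ 2 := by nlinarith only [hΛ]
  have hsum : 1474600 * K * d * Λ ^ 2 / L + (64 * K * d / L + 54 * K * d / L + 19 * K * d / L) ≤ 1474800 * K * d * Λ ^ 2 / L := by
    rw [← add_div, ← add_div, ← add_div]
    refine div_le_div_of_nonneg_right ?_ hL0.le
    nlinarith only [hΛ2, hKd]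
  linarith only [hT1, hT2, hT3, hT4, hsum]

/-! ## §3 ★★★ Every Lipschitz link in the uniform mixed-moment currency, up to `log²` [folklore] -/

variable [Nonempty ι]

/-- ★★★ **EVERY LIPSCHITZ LINK OF THE ℓ¹-NORM OF `d` STRINGS, IN THE UNIFORM MIXED-MOMENT CURRENCY, AT THE RIDGE RATE UP TO `log²`.**  Let `P, Q`
be probability laws on `ℝ^ι` carried by `[−1,1]^ι` (finite nonempty `ι`, `d = |ι|`) with `|∫∏x_i^{j_i}dP − ∫∏x_i^{j_i}dQ| ≤ e^{−L}` for every
multi-index `j`, `L ≥ 2^28`, and let `h : ℝ → ℝ` satisfy `|h(s) − h(s′)| ≤ K|s − s′|` on `ℝ` (`K ≥ 0`).  Then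
**`|∫h(Σ_i|x_i|)dP − ∫h(Σ_i|x_i|)dQ| ≤ 3·10⁶·K·d·(log₂L)²∕L`.**  PROOF: module 156's verbatim with module 167's log-free Jackson smoothing in place of
module 152a's (`h(S) − h(0)`; §1's parameters; module 155's polynomial with mass `≤ (π⁴KdL_F∕8)·e^{L∕2}`; module 145's price `2·sup + mass·e^{−L}`
with §2's bookkeeping and `(π⁴KdL_F∕8)e^{−L∕2} ≤ π⁴Kd∕L`).  Two-sided up to `log²` by module 138. [folklore] -/
theorem abs_integral_lipschitzLink_l1Norm_sub_le_of_closeMoments_logSq {P Q : Measure (ι → ℝ)} [IsProbabilityMeasure P] [IsProbabilityMeasure Q]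
    (hP : P (Set.pi Set.univ (fun _ : ι => Set.Icc (-1 : ℝ) 1))ᶜ = 0) (hQ : Q (Set.pi Set.univ (fun _ : ι => Set.Icc (-1 : ℝ) 1))ᶜ = 0)
    {L : ℝ} (hL : (2 : ℝ) ^ (28 : ℕ) ≤ L) (hmom : ∀ j : ι → ℕ, |∫ x, ∏ i, x i ^ j i ∂P - ∫ x, ∏ i, x i ^ j i ∂Q| ≤ Real.exp (-L))
    {h : ℝ → ℝ} {K : ℝ} (hK0 : 0 ≤ K) (hK : ∀ s s', |h s - h s'| ≤ K * |s - s'|) :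
    |∫ x, h (∑ i, |x i|) ∂P - ∫ x, h (∑ i, |x i|) ∂Q| ≤ 3000000 * K * Fintype.card ι * Real.logb 2 L ^ 2 / L := by
  set d : ℝ := (Fintype.card ι : ℝ) with hdd
  have hd : 0 < d := by rw [hdd]; exact_mod_cast Fintype.card_pos
  have hL0 : 0 < L := lt_of_lt_of_le (by positivity) hL
  have hLge : (268435456 : ℝ) ≤ L := le_trans (by norm_num) hL
  obtain ⟨hΛ28, hΛsq⟩ := logb_sq_le_L28 hL
  obtain ⟨LF, J, hh, N, hLF1, hLLF, hLFL, hh1, hJh, hexph, hJ1, hLππ, hNJ, hJsq, hN17, hbudget⟩ := exists_parameters_L2 hL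
  have hLFr : (1 : ℝ) ≤ LF := by exact_mod_cast hLF1
  have hLFL' : (LF : ℝ) ≤ L := by
    have h1 : (1 : ℝ) ≤ 104000 * Real.logb 2 L ^ 2 := by nlinarith only [hΛ28]
    exact (le_mul_of_one_le_left (by positivity) h1).trans hLFL
  -- the smoothing of the link on `[0, d]`
  have hK' : ∀ s s', s ∈ Set.Icc (0 : ℝ) d → s' ∈ Set.Icc (0 : ℝ) d → |h s - h s'| ≤ K * |s - s'| := fun s s' _ _ => hK s s'
  obtain ⟨α, β, ω, g, g₁, hω0, hωΩ, hW, hg, hg₁, hC11, hB1, herr⟩ := exists_trigLink_near_lipschitzLink_jackson hd hK0 hK' hLF1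
  have hΩ : (0 : ℝ) ≤ 2 * LF * π / d := by positivity
  -- the polynomial with mass
  obtain ⟨F, hFmass, hFerr⟩ := exists_mvPolynomial_near_trigLink_firstOrder_mass (ι := ι)
    (((range LF ×ˢ range LF) ×ˢ (range LF ×ˢ range LF)) ×ˢ (Finset.univ : Finset Bool)) (h 0) α β ω
    (Ω := 2 * LF * π / d) (W := π ^ 4 * (K * d) * LF / 8) (B₁ := K) (B₂ := K * π * LF / d) hg hg₁ hΩ hω0 hωΩ hW hC11 hB1 J hh N hh1 hJh hNJ
  -- the sup error on the cube
  have hS := fun (x : ι → ℝ) (hx : ∀ i, x i ∈ Set.Icc (-1 : ℝ) 1) => l1Norm_mem_Icc x hx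
  have hε : 2 * ((J : ℝ) + 1) * Real.exp (-(hh : ℝ)) ≤ 1 / (2 * L ^ 2) := by
    calc 2 * ((J : ℝ) + 1) * Real.exp (-(hh : ℝ)) ≤ 2 * (L / 4) * (1 / L ^ 3) := by
          have := mul_le_mul hJ1 hexph (Real.exp_pos _).le (by positivity)
          linarith only [this]
      _ = 1 / (2 * L ^ 2) := by field_simp; ring
  have hNJr : ((2 : ℝ) ^ J) ≤ N := by exact_mod_cast hNJ
  have hη := errorBound_L2 (M := (2 : ℝ) ^ J) (ε := 2 * ((J : ℝ) + 1) * Real.exp (-(hh : ℝ))) hK0 hd hLge hΛ28 hLFr hLFL' hLLF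
    hLππ hNJr hJsq hN17 hε
  have happ : ∀ x : ι → ℝ, (∀ i, x i ∈ Set.Icc (-1 : ℝ) 1) →
      |(h (∑ i, |x i|) - h 0) - MvPolynomial.eval x F| ≤ 1474800 * K * d * Real.logb 2 L ^ 2 / L := by
    intro x hx
    have h1 := herr (∑ i, |x i|) (by rw [hdd]; exact ⟨(hS x hx).1, (hS x hx).2⟩)
    have h2 := hFerr x hx
    rw [← hdd] at h2
    calc |(h (∑ i, |x i|) - h 0) - MvPolynomial.eval x F|
        ≤ |h (∑ i, |x i|) - g (∑ i, |x i|)| + |(g (∑ i, |x i|) - h 0) - MvPolynomial.eval x F| := by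
          have e : (h (∑ i, |x i|) - h 0) - MvPolynomial.eval x F =
              (h (∑ i, |x i|) - g (∑ i, |x i|)) + ((g (∑ i, |x i|) - h 0) - MvPolynomial.eval x F) := by ring
          rw [e]; exact abs_add_le _ _
      _ ≤ _ := add_le_add h1 h2
      _ ≤ 1474800 * K * d * Real.logb 2 L ^ 2 / L := hη
  -- the mass budget: `mass F · e^{−L} ≤ (π⁴KdL_F/8) · e^{−L/2} ≤ π⁴Kd/L`
  have hmass : (∑ s ∈ F.support, |F.coeff s|) * Real.exp (-L) ≤ π ^ 4 * K * d / L := by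
    have hW0 : 0 ≤ π ^ 4 * (K * d) * (LF : ℝ) / 8 := by positivity
    have e : 2 * LF * π / d * (Fintype.card ι : ℝ) = 2 * LF * π := by rw [← hdd]; field_simp
    rw [e] at hFmass
    have h1 : (∑ s ∈ F.support, |F.coeff s|) ≤ π ^ 4 * (K * d) * LF / 8 * Real.exp (L / 2) := by
      refine hFmass.trans ?_
      rw [mul_assoc]
      refine mul_le_mul_of_nonneg_left ?_ hW0
      rw [← Real.exp_log (show (0 : ℝ) < 1 + 2 * (2 * LF * π) * (N * 9 ^ N) by positivity), ← Real.exp_add]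
      exact Real.exp_le_exp.2 hbudget
    have h2 : L ^ 2 * Real.exp (-(L / 2)) ≤ 8 := by
      have h3 : (L / 2) ^ 2 / 2 ≤ Real.exp (L / 2) := by
        have := Real.quadratic_le_exp_of_nonneg (show 0 ≤ L / 2 by positivity)
        linarith
      rw [Real.exp_neg]
      have h4 : 0 < Real.exp (L / 2) := Real.exp_pos _
      rw [mul_inv_le_iff₀ h4]
      nlinarith only [h3]
    calc (∑ s ∈ F.support, |F.coeff s|) * Real.exp (-L) ≤ π ^ 4 * (K * d) * LF / 8 * Real.exp (L / 2) * Real.exp (-L) :=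
          mul_le_mul_of_nonneg_right h1 (Real.exp_pos _).le
      _ = π ^ 4 * (K * d) * LF / 8 * Real.exp (-(L / 2)) := by rw [mul_assoc, ← Real.exp_add]; ring_nf
      _ ≤ π ^ 4 * (K * d) * L / 8 * Real.exp (-(L / 2)) := by
          have := mul_le_mul_of_nonneg_right hLFL' (by positivity : (0 : ℝ) ≤ π ^ 4 * (K * d) / 8 * Real.exp (-(L / 2)))
          nlinarith only [this]
      _ = π ^ 4 * (K * d) / 8 / L * (L ^ 2 * Real.exp (-(L / 2))) := by field_simp
      _ ≤ π ^ 4 * (K * d) / 8 / L * 8 := mul_le_mul_of_nonneg_left h2 (by positivity)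
      _ = π ^ 4 * K * d / L := by ring
  -- the price
  have hLip : LipschitzWith (Real.toNNReal K) h := by
    refine LipschitzWith.of_dist_le_mul fun x y => ?_
    rw [Real.dist_eq, Real.dist_eq, Real.coe_toNNReal _ hK0]
    exact hK x y
  have hcont : Continuous fun x : ι → ℝ => h (∑ i, |x i|) := hLip.continuous.comp continuous_l1Norm
  have hg0 : Continuous fun x : ι → ℝ => h (∑ i, |x i|) - h 0 := hcont.sub continuous_const
  have hprice := abs_integral_sub_le_of_near_mass hP hQ (Real.exp_pos _).le hmom hg0 happ le_rfl
  -- the constant integrates to zero difference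
  have hconst : ∫ x, h (∑ i, |x i|) ∂P - ∫ x, h (∑ i, |x i|) ∂Q =
      ∫ x, (h (∑ i, |x i|) - h 0) ∂P - ∫ x, (h (∑ i, |x i|) - h 0) ∂Q := by
    rw [integral_sub (integrable_of_continuous_of_cube hP hcont) (integrable_const _),
      integral_sub (integrable_of_continuous_of_cube hQ hcont) (integrable_const _)]
    simp only [MeasureTheory.integral_const, smul_eq_mul, probReal_univ]
    ring
  rw [hconst]
  refine hprice.trans ?_
  have hKd : 0 ≤ K * d := mul_nonneg hK0 hd.le
  have hΛ2 : 1 ≤ Real.logb 2 L ^ 2 := one_le_pow₀ (by linarith only [hΛ28])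
  have hπ4 : π ^ 4 ≤ 98.5 := by
    have hπhi : π < 3.15 := Real.pi_lt_d2
    have hπ2 : π ^ 2 < 3.15 * 3.15 := by rw [pow_two]; exact mul_lt_mul'' hπhi hπhi Real.pi_pos.le Real.pi_pos.le
    nlinarith only [hπ2, pow_pos Real.pi_pos 2]
  have e : 2 * (1474800 * K * d * Real.logb 2 L ^ 2 / L) + π ^ 4 * K * d / L =
      (2949600 * K * d * Real.logb 2 L ^ 2 + π ^ 4 * K * d) / L := by ring
  rw [hdd] at hmass e ⊢
  calc 2 * (1474800 * K * (Fintype.card ι : ℝ) * Real.logb 2 L ^ 2 / L) + (∑ s ∈ F.support, |F.coeff s|) * Real.exp (-L)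
      ≤ 2 * (1474800 * K * (Fintype.card ι : ℝ) * Real.logb 2 L ^ 2 / L) + π ^ 4 * K * (Fintype.card ι : ℝ) / L := add_le_add le_rfl hmass
    _ = (2949600 * K * (Fintype.card ι : ℝ) * Real.logb 2 L ^ 2 + π ^ 4 * K * (Fintype.card ι : ℝ)) / L := e
    _ ≤ 3000000 * K * Fintype.card ι * Real.logb 2 L ^ 2 / L := by
        refine div_le_div_of_nonneg_right ?_ hL0.le
        rw [← hdd]
        have hx : π ^ 4 * K * d ≤ 98.5 * (K * d) := by
          have := mul_le_mul_of_nonneg_right hπ4 hKd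
          linarith only [this, show π ^ 4 * K * d = π ^ 4 * (K * d) by ring]
        nlinarith only [hKd, hΛ2, hx]

end Summit.QuantumFields.YangMills.Theorems.BalabanUVNodesN19LipschitzLinksMomentBudgetLogSq

end
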